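import Mathlib
import Summits.NavierStokesRegularity.NavierStokesRegularity.Theorems.OrthantWakeDefs
import Summits.NavierStokesRegularity.NavierStokesRegularity.Theorems.OrthantWakeOrthantTableStructure
import Literature.Analysis.FluidPDE.Tao2016AveragedNS.LocalCascadeSolutions
import HarnessLib

/-!
# The twin side-branch table `twin-α_SB` is an ALL-SOURCE ORTHANT table of `E₂(17)`
(helper file for item stmt-NavierStokesRegularity-26438 `OrthantWake.ForwardHopWake`; `--supports`;
also serves the reductions for items 26608 `SubOnsagerCeiling.ForwardTailCeiling` and 26373
`SubcriticalEnvelope.ForwardSourceTailEnvelope`)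

`twinSideBranchTable` (`Theorems/OrthantWakeDefs.lean`) is the side-branch dead-end table `α_SB`
with its pocket feed split into twin feeds (`3/25`, `4/25`) and the rank-one DIFFERENTIAL FEED
`(4x_{2,k} − 3x_{3,k})²/16 → x_{0,k+1}` (symmetric back-reaction split). This file checks in the
kernel that it is ADMISSIBLE for every "forward-source" crux of the TL-M2Break cluster and that the
syntactic source set is EVERYTHING:

* `twinSideBranchTable_inTableClass : InTableClass 17 twinSideBranchTable` (symmetric (4.2),
  cancelling (4.3), moduli `≤ 1`, non-zero moduli `≥ 1/17`);
* `twinSideBranchTable_orthant` — the orthant (Kamke) hypothesis of the cruxes, verbatim, via the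
  tree's finite criterion `orthant_iff_coefficients` (feed forms `w_0² + (4w_2 − 3w_3)²/16`,
  `(3/25)w_1²`, `(4/25)w_1²`, `0`; cross back-reactions `3/8 + 3/8 ≥ 0`; in-shell = the pump);
* `twinSideBranchTable_allSource` — every `S` with `i ∉ S → α i j l (0,0,1) = 0` is `univ`.

So on this table the forward-source tail energies `Σ_{i∈S}` of the cruxes ARE the total tail
energies. Orthant ⊋ Katz–Pavlović network: differential feeds have a negative cross entry
(`α_{230,(0,0,1)} = −3/4`) and are outside every pump-network instrument of record.

HONEST FRAMING: finite algebra about a Tao-type MODEL lattice table (rung TL-M2Break); no crux is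
proved or refuted here; nothing bears on Navier–Stokes regularity.
-/

noncomputable section

-- the sub-problem namespace `NavierStokesRegularity.NavierStokesRegularity` is the tree's layout (D-0017)
set_option linter.dupNamespace false

namespace Summit.NavierStokesRegularity.NavierStokesRegularity.Theorems

open Literature.Analysis.FluidPDE.TaoCascade

/-! ## Closed forms on the four shifts -/

/-- Values on the feed shift `(0,0,1)`. [this file] -/
theorem twinSideBranchTable_feed (i₁ i₂ i₃ : Fin 4) :
    twinSideBranchTable i₁ i₂ i₃ ((0 : ℤ), (0 : ℤ), (1 : ℤ)) =
      (if i₁ = 0 ∧ i₂ = 0 ∧ i₃ = 0 then (1 : ℝ) else 0) +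
      (if i₁ = 1 ∧ i₂ = 1 ∧ i₃ = 2 then 3 / 25 else 0) +
      (if i₁ = 1 ∧ i₂ = 1 ∧ i₃ = 3 then 4 / 25 else 0) +
      (if i₁ = 2 ∧ i₂ = 2 ∧ i₃ = 0 then 1 else 0) +
      (if i₁ = 3 ∧ i₂ = 3 ∧ i₃ = 0 then 9 / 16 else 0) +
      (if ((i₁ = 2 ∧ i₂ = 3) ∨ (i₁ = 3 ∧ i₂ = 2)) ∧ i₃ = 0 then -(3 / 4) else 0) := by
  simp [twinSideBranchTable]

/-- Values on the shift `(1,0,0)` (first slot one shell up). [this file] -/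
theorem twinSideBranchTable_up1 (i₁ i₂ i₃ : Fin 4) :
    twinSideBranchTable i₁ i₂ i₃ ((1 : ℤ), (0 : ℤ), (0 : ℤ)) =
      (if i₁ = 0 ∧ i₂ = 0 ∧ i₃ = 0 then (-(1 / 2) : ℝ) else 0) +
      (if i₁ = 2 ∧ i₂ = 1 ∧ i₃ = 1 then -(3 / 50) else 0) +
      (if i₁ = 3 ∧ i₂ = 1 ∧ i₃ = 1 then -(2 / 25) else 0) +
      (if i₁ = 0 ∧ i₂ = 2 ∧ i₃ = 2 then -(1 / 2) else 0) +
      (if i₁ = 0 ∧ i₂ = 3 ∧ i₃ = 3 then -(9 / 32) else 0) +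
      (if i₁ = 0 ∧ i₂ = 2 ∧ i₃ = 3 then 3 / 8 else 0) +
      (if i₁ = 0 ∧ i₂ = 3 ∧ i₃ = 2 then 3 / 8 else 0) := by
  simp [twinSideBranchTable]

/-- Values on the shift `(0,1,0)` (second slot one shell up). [this file] -/
theorem twinSideBranchTable_up2 (i₁ i₂ i₃ : Fin 4) :
    twinSideBranchTable i₁ i₂ i₃ ((0 : ℤ), (1 : ℤ), (0 : ℤ)) =
      (if i₁ = 0 ∧ i₂ = 0 ∧ i₃ = 0 then (-(1 / 2) : ℝ) else 0) +
      (if i₁ = 1 ∧ i₂ = 2 ∧ i₃ = 1 then -(3 / 50) else 0) +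
      (if i₁ = 1 ∧ i₂ = 3 ∧ i₃ = 1 then -(2 / 25) else 0) +
      (if i₁ = 2 ∧ i₂ = 0 ∧ i₃ = 2 then -(1 / 2) else 0) +
      (if i₁ = 3 ∧ i₂ = 0 ∧ i₃ = 3 then -(9 / 32) else 0) +
      (if i₁ = 2 ∧ i₂ = 0 ∧ i₃ = 3 then 3 / 8 else 0) +
      (if i₁ = 3 ∧ i₂ = 0 ∧ i₃ = 2 then 3 / 8 else 0) := by
  simp [twinSideBranchTable]

/-- Values on the in-shell shift `(0,0,0)` (the side pump of `α_SB`). [this file] -/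
theorem twinSideBranchTable_inshell (i₁ i₂ i₃ : Fin 4) :
    twinSideBranchTable i₁ i₂ i₃ ((0 : ℤ), (0 : ℤ), (0 : ℤ)) =
      (if i₁ = 0 ∧ i₂ = 0 ∧ i₃ = 1 then (1 / 5 : ℝ) else 0) +
      (if ((i₁ = 0 ∧ i₂ = 1) ∨ (i₁ = 1 ∧ i₂ = 0)) ∧ i₃ = 0 then -(1 / 10) else 0) := by
  simp [twinSideBranchTable]

/-! ## The table class and the orthant property -/

/-- `twin-α_SB` satisfies Tao's symmetry condition (4.2). [this file] -/
theorem twinSideBranchTable_symmetric : IsSymmetricCoeff twinSideBranchTable := by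
  intro i₁ i₂ i₃ μ₁ μ₂ μ₃ hμ
  rw [mem_shiftSet_iff] at hμ
  simp only [Prod.mk.injEq] at hμ
  rcases hμ with ⟨rfl, rfl, rfl⟩ | ⟨rfl, rfl, rfl⟩ | ⟨rfl, rfl, rfl⟩ | ⟨rfl, rfl, rfl⟩
  · simp only [twinSideBranchTable_inshell]
    fin_cases i₁ <;> fin_cases i₂ <;> fin_cases i₃ <;> simp
  · simp only [twinSideBranchTable_up1, twinSideBranchTable_up2]
    fin_cases i₁ <;> fin_cases i₂ <;> fin_cases i₃ <;> simp
  · simp only [twinSideBranchTable_up1, twinSideBranchTable_up2]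
    fin_cases i₁ <;> fin_cases i₂ <;> fin_cases i₃ <;> simp
  · simp only [twinSideBranchTable_feed]
    fin_cases i₁ <;> fin_cases i₂ <;> fin_cases i₃ <;> simp

/-- `twin-α_SB` satisfies Tao's cancellation condition (4.3). [this file] -/
theorem twinSideBranchTable_cancelling : IsCancellingCoeff twinSideBranchTable := by
  intro i₁ i₂ i₃ μ₁ μ₂ μ₃ hμ
  rw [mem_shiftSet_iff] at hμ
  simp only [Prod.mk.injEq] at hμ
  rcases hμ with ⟨rfl, rfl, rfl⟩ | ⟨rfl, rfl, rfl⟩ | ⟨rfl, rfl, rfl⟩ | ⟨rfl, rfl, rfl⟩ <;>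
    simp only [twinSideBranchTable_inshell, twinSideBranchTable_feed, twinSideBranchTable_up1,
      twinSideBranchTable_up2] <;>
    fin_cases i₁ <;> fin_cases i₂ <;> fin_cases i₃ <;> simp <;> norm_num

/-- `twin-α_SB` is `17`-comparable: moduli `≤ 1`, non-zero moduli `≥ 1/17` (the smallest is `3/50`).
[this file] -/
theorem twinSideBranchTable_comparable : IsComparableCoeff 17 twinSideBranchTable := by
  intro i₁ i₂ i₃ μ hμ
  rw [mem_shiftSet_iff] at hμ
  rcases hμ with rfl | rfl | rfl | rfl <;>
    simp only [twinSideBranchTable_inshell, twinSideBranchTable_feed, twinSideBranchTable_up1,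
      twinSideBranchTable_up2] <;>
    fin_cases i₁ <;> fin_cases i₂ <;> fin_cases i₃ <;> simp <;> norm_num

/-- **`twin-α_SB` lies in the table class `E₂(17)`.** [this file] -/
theorem twinSideBranchTable_inTableClass : InTableClass 17 twinSideBranchTable :=
  ⟨twinSideBranchTable_symmetric, twinSideBranchTable_cancelling, twinSideBranchTable_comparable⟩

/-- **`twin-α_SB` is an ORTHANT (Kamke) table**, via the tree's finite criterion
`orthant_iff_coefficients`: the feed forms are `w_0² + (4w_2 − 3w_3)²/16`, `(3/25)w_1²`,
`(4/25)w_1²`, `0` (all `≥ 0` on `ℝ⁴`); the only cross back-reactions are `3/8 + 3/8 ≥ 0`; in-shell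
forms are the pump of `α_SB`. [this file] -/
theorem twinSideBranchTable_orthant :
    ∀ (Y : Fin 4 → ℤ → ℝ → ℝ) (τ : ℝ), (∀ (j : Fin 4) (k : ℤ), 1 ≤ k → 0 ≤ Y j k τ) →
      ∀ δ : ℝ, 0 < δ → ∀ (i : Fin 4) (n : ℤ), 1 ≤ n → Y i n τ = 0 →
        0 ≤ quadTerm δ twinSideBranchTable Y i n τ := by
  rw [orthant_iff_coefficients]
  refine ⟨?_, ?_, ?_⟩
  · intro i w
    simp only [twinSideBranchTable_feed, Fin.sum_univ_four]
    fin_cases i <;> simp <;>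
      nlinarith [mul_self_nonneg (w 0), mul_self_nonneg (w 1), mul_self_nonneg (4 * w 2 - 3 * w 3)]
  · intro i a b hbi
    simp only [twinSideBranchTable_up1, twinSideBranchTable_up2]
    fin_cases i <;> fin_cases a <;> fin_cases b <;> simp at hbi ⊢ <;> norm_num
  · intro i y hy hyi
    simp only [twinSideBranchTable_inshell, Fin.sum_univ_four]
    fin_cases i <;> simp at hyi ⊢ <;> nlinarith [mul_self_nonneg (y 0), hy 0, hy 1, hyi]

/-- **Every component of `twin-α_SB` is a syntactic forward source**: any `S` containing all
sources (`i ∉ S → α i j l (0,0,1) = 0`) is the whole of `Fin 4`. [this file] -/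
theorem twinSideBranchTable_allSource (S : Finset (Fin 4))
    (hS : ∀ i, i ∉ S → ∀ j l : Fin 4, twinSideBranchTable i j l (0, 0, 1) = 0) :
    S = Finset.univ := by
  rw [Finset.eq_univ_iff_forall]
  intro i
  by_contra hi
  fin_cases i
  · have h := hS 0 hi 0 0
    rw [twinSideBranchTable_feed] at h
    simp at h
  · have h := hS 1 hi 1 2
    rw [twinSideBranchTable_feed] at h
    simp at h
  · have h := hS 2 hi 2 0
    rw [twinSideBranchTable_feed] at h
    simp at h
  · have h := hS 3 hi 3 0
    rw [twinSideBranchTable_feed] at h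
    simp at h


end Summit.NavierStokesRegularity.NavierStokesRegularity.Theorems

end
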